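import Literature.Dynamics.Tilings.TorusCNFGluingExtend
import Literature.Computability.MetaComplexity.ResolutionWidthFamilies
import Literature.Computability.MetaComplexity.ResolutionProofs
import HarnessLib

/-!
# Resolution width of the torus CNFs of strongly irreducible tiling families

Topic `Literature/Dynamics/Tilings`. Let `T` be a Wang tile set and suppose its valid tilings of
`ℤ²` contain a nonempty SHIFT-INVARIANT family `Y` with FINITE-SET GLUING AT SUP-DISTANCE `> g`
(strong irreducibility with gap `g`, cf. M. Hochman's survey notion, restricted to finite sets):
for all finite `E, F ⊆ ℤ²` at mutual sup-distance `> g` and all `x, y ∈ Y` some `z ∈ Y` agrees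
with `x` on `E` and with `y` on `F`. Then every resolution refutation `π` of the torus CNF
`torusCNF T n` ("`T` tiles the `n × n` torus", `TorusCNF.lean`) satisfies

  `n ≤ g · (resWidth π + 2)`            (`resWidth_torusCNF_of_gluing`).

For `g = 0` this says that no refutation exists: indeed gluing a tiling with its own shift by `n`
across a column and a row shows that every `x ∈ Y` restricts to a tiling of the torus
(`satisfiable_of_gap_zero`). For `g ≥ 1` it is a Duplicator strategy in the Atserias–Dalmau
width game (`ResolutionWidthFamilies.lt_resWidth_of_family`): the family `family t g n Y` of
records whose pebbled cells admit a good lift to the plane (`TorusCNFGluingLifts.GoodLift`)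
realised by one tiling `z ∈ Y` (`Agrees`) contains `∅`, is closed under sub-records, falsifies
no clause when `g + 1 < n` (`family_consistent`: adjacent cells lift to adjacent points, where `z`
is valid), and extends below size `w` when `g(w+1) < n` (`family_extend`: re-lift the touched
clusters, `TorusCNFGluingExtend.exists_transl`, and glue shifted copies of `z` cluster by cluster,
`exists_glued`).

The statement is item `GluingSubshiftWidth` of route `PneNP/AperiodicTorus` (the Summits file
`AperiodicTorusGluingSubshiftWidth.lean` only unfolds the inlined encoding); it is new as stated
(no published source), the game-theoretic method is Atserias–Dalmau's.

## References

* A. Atserias, V. Dalmau, *A combinatorial characterization of resolution width*, J. Comput.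
  Syst. Sci. 74 (2008) 323–334 [AtseriasDalmau2008].
* E. Jeandel, P. Vanier, *The undecidability of the Domino Problem*, LNM 2273 (2020), §1
  (tilings, tori) [JeandelVanier2020].
-/

namespace Literature.Dynamics.Tilings

namespace TorusGluing

open Finset Literature.Computability.Complexity Literature.Computability.MetaComplexity

universe v

variable {C : Type v} [DecidableEq C] {t : ℕ}

/-! ### The hypotheses on the family of tilings -/

/-- A **gluing family** for the tile set `T` with gap `g`: a nonempty, shift-invariant set `Y` of
valid plane tilings by `T` in which any two members can be glued along finite sets at mutual
sup-distance `> g` (strong irreducibility with gap `g`, restricted to finite sets). [folklore] -/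
structure GluingFamily (T : WangTileSet (Fin t) C) (g : ℕ) (Y : Set (ℤ → ℤ → Fin t)) : Prop where
  /-- `Y` is nonempty -/
  nonempty : Y.Nonempty
  /-- every member is a valid tiling of the plane -/
  valid : ∀ x ∈ Y, T.IsPlaneTiling x
  /-- `Y` is shift invariant -/
  shift : ∀ x ∈ Y, ∀ a b : ℤ, (fun i j => x (i + a) (j + b)) ∈ Y
  /-- finite-set gluing at sup-distance `> g` -/
  glue : ∀ E F : Finset (ℤ × ℤ), (∀ p ∈ E, ∀ q ∈ F, (g : ℤ) < max |p.1 - q.1| |p.2 - q.2|) →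
    ∀ x ∈ Y, ∀ y ∈ Y, ∃ z ∈ Y, (∀ p ∈ E, z p.1 p.2 = x p.1 p.2) ∧ (∀ q ∈ F, z q.1 q.2 = y q.1 q.2)

/-- A nonempty set of maps into `Fin t` forces `t ≥ 1`. [folklore] -/
theorem pos_of_nonempty {Y : Set (ℤ → ℤ → Fin t)} (hY : Y.Nonempty) : 0 < t := by
  obtain ⟨x, -⟩ := hY
  exact Fin.pos (x 0 0)

/-! ### The Duplicator family -/

/-- The record `α` AGREES with the tiling `z` read at the lift `L` of its cells: a literal
`(x_(i,j,s), b) ∈ α` on an in-range variable holds iff (`z` carries tile `s` at `L (i, j)` iff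
`b = true`). Out-of-range variables are unconstrained. [folklore] -/
def Agrees (t n : ℕ) (α : Finset (Literal ℕ)) (L : ℕ × ℕ → ℤ × ℤ) (z : ℤ → ℤ → Fin t) : Prop :=
  ∀ l ∈ α, l.1 < n * n * t →
    ((z (L (cellOf t n l.1)).1 (L (cellOf t n l.1)).2).1 = tileOf t l.1 ↔ l.2 = true)

/-- **The Duplicator family** of the torus CNF: records whose cells admit a good lift realised by
a member of `Y`. [folklore] -/
def family (t g n : ℕ) (Y : Set (ℤ → ℤ → Fin t)) : Set (Finset (Literal ℕ)) :=
  {α | ∃ (L : ℕ × ℕ → ℤ × ℤ) (z : ℤ → ℤ → Fin t), z ∈ Y ∧ GoodLift g n (cells t n α) L ∧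
    Agrees t n α L z}

/-- The empty record belongs to the family. [folklore] -/
theorem empty_mem_family {g n : ℕ} {Y : Set (ℤ → ℤ → Fin t)} (hY : Y.Nonempty) :
    (∅ : Finset (Literal ℕ)) ∈ family t g n Y := by
  obtain ⟨z, hz⟩ := hY
  refine ⟨canon, z, hz, ?_, fun l hl => absurd hl (Finset.notMem_empty _)⟩
  have : cells t n (∅ : Finset (Literal ℕ)) = ∅ := by simp [cells]
  rw [this]
  exact goodLift_empty g n _

/-- The family is closed under sub-records. [folklore] -/
theorem family_down {g n : ℕ} {Y : Set (ℤ → ℤ → Fin t)} {α β : Finset (Literal ℕ)}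
    (hα : α ∈ family t g n Y) (hβ : β ⊆ α) : β ∈ family t g n Y := by
  obtain ⟨L, z, hz, hL, hag⟩ := hα
  exact ⟨L, z, hz, hL.mono (cells_mono hβ), fun l hl hlt => hag l (hβ hl) hlt⟩

/-! ### Consistency: no clause of the torus CNF is falsified -/

/-- The successor modulo `n` differs from `j + 1` by a multiple of `n`. [folklore] -/
theorem dvd_one_sub_mod_sub {n : ℕ} (j : ℕ) :
    (n : ℤ) ∣ 1 - ((((j + 1) % n : ℕ) : ℤ) - j) := by
  refine ⟨((j : ℤ) + 1) / n, ?_⟩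
  push_cast
  rw [Int.emod_def]
  ring

/-- **Consistency of the family.** For `1 ≤ g` and `g + 1 < n` no record of the family falsifies
a clause of `torusCNF T n`: the at-least-one / at-most-one clauses because `z` carries exactly one
tile at the lifted cell, the mismatch clauses because torus-adjacent cells are lifted to adjacent
points of the plane (`GoodLift.sub_eq_of_unit`), where `z` is a valid tiling. [folklore] -/
theorem family_consistent (T : WangTileSet (Fin t) C) {g n : ℕ} {Y : Set (ℤ → ℤ → Fin t)}
    (hY : GluingFamily T g Y) (hg : 1 ≤ g) (hgn : g + 1 < n) {α : Finset (Literal ℕ)}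
    (hα : α ∈ family t g n Y) : ∀ c ∈ T.torusCNF n, ¬ Falsifies α c.toFinset := by
  intro c hc hf
  obtain ⟨L, z, hz, hL, hag⟩ := hα
  have hval := hY.valid z hz
  -- reading a positive literal of `α` off `z`
  have hpos : ∀ (i j : Fin n) (s : Fin t), (WangTileSet.torusVar t n i j s, true) ∈ α →
      z (L (i.1, j.1)).1 (L (i.1, j.1)).2 = s := by
    intro i j s hmem
    have h := hag _ hmem (torusVar_lt i j s)
    rw [cellOf_torusVar, tileOf_torusVar] at h
    exact Fin.ext (h.2 rfl)
  have hfals : ∀ l ∈ c, l.negate ∈ α := fun l hl => hf l (List.mem_toFinset.2 hl)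
  rcases (WangTileSet.mem_torusCNF_iff T n c).1 hc with
    ⟨i, j, rfl⟩ | ⟨i, j, s, s', hlt, rfl⟩ | ⟨i, j, s, s', hne, rfl⟩ | ⟨i, j, s, s', hne, rfl⟩
  · -- at least one tile: `z` carries one
    set s₀ : Fin t := z (L (i.1, j.1)).1 (L (i.1, j.1)).2 with hs₀
    have hmem : (WangTileSet.torusVar t n i j s₀, false) ∈ α := by
      have := hfals (WangTileSet.torusVar t n i j s₀, true)
        (List.mem_map.2 ⟨s₀, List.mem_finRange s₀, rfl⟩)
      simpa [Literal.negate] using this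
    have h := hag _ hmem (torusVar_lt i j s₀)
    rw [cellOf_torusVar, tileOf_torusVar] at h
    exact Bool.false_ne_true (h.1 (by rw [hs₀]))
  · -- at most one tile
    have h1 : (WangTileSet.torusVar t n i j s, true) ∈ α := by
      simpa [Literal.negate] using hfals (WangTileSet.torusVar t n i j s, false) (by simp)
    have h2 : (WangTileSet.torusVar t n i j s', true) ∈ α := by
      simpa [Literal.negate] using hfals (WangTileSet.torusVar t n i j s', false) (by simp)
    have e := (hpos i j s h1).symm.trans (hpos i j s' h2)
    exact absurd hlt (by rw [e]; exact lt_irrefl _)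
  · -- horizontal mismatch
    set j' : Fin n := ⟨(j.1 + 1) % n, Nat.mod_lt _ j.pos⟩ with hj'
    have h1 : (WangTileSet.torusVar t n i j s, true) ∈ α := by
      simpa [Literal.negate] using hfals (WangTileSet.torusVar t n i j s, false) (by simp)
    have h2 : (WangTileSet.torusVar t n i j' s', true) ∈ α := by
      simpa [Literal.negate] using hfals (WangTileSet.torusVar t n i j' s', false) (by simp [hj'])
    have ha : ((i.1, j.1) : ℕ × ℕ) ∈ cells t n α := by
      simpa [cellOf_torusVar] using mem_cells_of_mem h1 (torusVar_lt i j s)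
    have hb : ((i.1, j'.1) : ℕ × ℕ) ∈ cells t n α := by
      simpa [cellOf_torusVar] using mem_cells_of_mem h2 (torusVar_lt i j' s')
    have hdiff : L (i.1, j'.1) - L (i.1, j.1) = ((0 : ℤ), (1 : ℤ)) :=
      hL.sub_eq_of_unit hg hgn ha hb (by simp) (by simp) (by simp) (by simpa [hj'] using dvd_one_sub_mod_sub (n := n) j.1)
    have e1 : (L (i.1, j'.1)).1 = (L (i.1, j.1)).1 := by
      have := congrArg Prod.fst hdiff; simp at this; linarith
    have e2 : (L (i.1, j'.1)).2 = (L (i.1, j.1)).2 + 1 := by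
      have := congrArg Prod.snd hdiff; simp at this; linarith
    have hv := (hval (L (i.1, j.1)).1 (L (i.1, j.1)).2).1
    rw [hpos i j s h1, ← e1, ← e2, hpos i j' s' h2] at hv
    exact hne hv
  · -- vertical mismatch
    set i' : Fin n := ⟨(i.1 + 1) % n, Nat.mod_lt _ i.pos⟩ with hi'
    have h1 : (WangTileSet.torusVar t n i j s, true) ∈ α := by
      simpa [Literal.negate] using hfals (WangTileSet.torusVar t n i j s, false) (by simp)
    have h2 : (WangTileSet.torusVar t n i' j s', true) ∈ α := by
      simpa [Literal.negate] using hfals (WangTileSet.torusVar t n i' j s', false) (by simp [hi'])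
    have ha : ((i.1, j.1) : ℕ × ℕ) ∈ cells t n α := by
      simpa [cellOf_torusVar] using mem_cells_of_mem h1 (torusVar_lt i j s)
    have hb : ((i'.1, j.1) : ℕ × ℕ) ∈ cells t n α := by
      simpa [cellOf_torusVar] using mem_cells_of_mem h2 (torusVar_lt i' j s')
    have hdiff : L (i'.1, j.1) - L (i.1, j.1) = ((1 : ℤ), (0 : ℤ)) :=
      hL.sub_eq_of_unit hg hgn ha hb (by simp) (by simp) (by simpa [hi'] using dvd_one_sub_mod_sub (n := n) i.1) (by simp)
    have e1 : (L (i'.1, j.1)).1 = (L (i.1, j.1)).1 + 1 := by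
      have := congrArg Prod.fst hdiff; simp at this; linarith
    have e2 : (L (i'.1, j.1)).2 = (L (i.1, j.1)).2 := by
      have := congrArg Prod.snd hdiff; simp at this; linarith
    have hv := (hval (L (i.1, j.1)).1 (L (i.1, j.1)).2).2
    rw [hpos i j s h1, ← e1, ← e2, hpos i' j s' h2] at hv
    exact hne hv

/-! ### Gluing shifted copies of a tiling along the re-lifted clusters -/

/-- **Gluing along the clusters.** Given translation vectors `τ` (zero on untouched cells,
divisible by `n`, constant on touched clusters) and `z ∈ Y`, some `z' ∈ Y` carries at every
re-lifted cell `L a + τ a` the tile that `z` carries at `L a`: glue the shifted copies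
`z(· - τ)` of `z` one translation vector at a time, the pieces being pairwise at sup-distance
`> g` (`separated_of_ne_transl`, `separated_of_not_touched`). [folklore] -/
theorem exists_glued {g n : ℕ} {Y : Set (ℤ → ℤ → Fin t)}
    (hshift : ∀ x ∈ Y, ∀ a b : ℤ, (fun i j => x (i + a) (j + b)) ∈ Y)
    (hglue : ∀ E F : Finset (ℤ × ℤ), (∀ p ∈ E, ∀ q ∈ F, (g : ℤ) < max |p.1 - q.1| |p.2 - q.2|) →
      ∀ x ∈ Y, ∀ y ∈ Y, ∃ z ∈ Y, (∀ p ∈ E, z p.1 p.2 = x p.1 p.2) ∧ (∀ q ∈ F, z q.1 q.2 = y q.1 q.2))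
    {S : Finset (ℕ × ℕ)} {L : ℕ × ℕ → ℤ × ℤ} (hL : GoodLift g n S L) {c : ℕ × ℕ}
    {τ : ℕ × ℕ → ℤ × ℤ} (h0 : ∀ a, ¬ Touched g n S c a → τ a = 0)
    (h1 : ∀ a, Touched g n S c a → (n : ℤ) ∣ (τ a).1 ∧ (n : ℤ) ∣ (τ a).2)
    (h2 : ∀ a b, Touched g n S c a → (proxGraph g n S).Reachable a b → τ a = τ b)
    {z : ℤ → ℤ → Fin t} (hz : z ∈ Y) :
    ∃ z' ∈ Y, ∀ a ∈ S, z' (L a + τ a).1 (L a + τ a).2 = z (L a).1 (L a).2 := by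
  classical
  -- gluing the clusters whose translation vector lies in `U`, by induction on `U`
  have key : ∀ U : Finset (ℤ × ℤ), ∃ z' ∈ Y, ∀ a ∈ S, (¬ Touched g n S c a ∨ τ a ∈ U) →
      z' (L a + τ a).1 (L a + τ a).2 = z (L a).1 (L a).2 := by
    intro U
    induction U using Finset.induction_on with
    | empty =>
      refine ⟨z, hz, fun a _ h => ?_⟩
      rcases h with h | h
      · rw [h0 a h, add_zero]
      · exact absurd h (Finset.notMem_empty _)
    | insert T₀ U hT₀ ih =>
      obtain ⟨z₁, hz₁, hz₁E⟩ := ih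
      -- the pieces
      let E : Finset (ℤ × ℤ) :=
        (S.filter fun a => ¬ Touched g n S c a ∨ τ a ∈ U).image fun a => L a + τ a
      let F : Finset (ℤ × ℤ) :=
        (S.filter fun a => Touched g n S c a ∧ τ a = T₀).image fun a => L a + τ a
      have hsep : ∀ p ∈ E, ∀ q ∈ F, (g : ℤ) < max |p.1 - q.1| |p.2 - q.2| := by
        intro p hp q hq
        obtain ⟨b, hb, rfl⟩ := Finset.mem_image.1 hp
        obtain ⟨a, ha, rfl⟩ := Finset.mem_image.1 hq
        obtain ⟨hbS, hb⟩ := Finset.mem_filter.1 hb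
        obtain ⟨-, hta, hτa⟩ := Finset.mem_filter.1 ha
        change (g : ℤ) < supDist (L b + τ b) (L a + τ a)
        by_cases htb : Touched g n S c b
        · have hU : τ b ∈ U := hb.resolve_left (fun h => h htb)
          have hne : τ b ≠ τ a := by rw [hτa]; exact fun h => hT₀ (h ▸ hU)
          exact separated_of_ne_transl hL h1 h2 htb hta hne
        · rw [h0 b htb, add_zero]
          exact separated_of_not_touched hL h1 hta hbS htb
      -- the shifted copy of `z`
      have hzT : (fun i j => z (i + -T₀.1) (j + -T₀.2)) ∈ Y := hshift z hz _ _
      obtain ⟨z₂, hz₂, hE, hF⟩ := hglue E F hsep z₁ hz₁ _ hzT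
      refine ⟨z₂, hz₂, fun a ha h => ?_⟩
      by_cases hcase : ¬ Touched g n S c a ∨ τ a ∈ U
      · rw [← hz₁E a ha hcase]
        exact hE _ (Finset.mem_image.2 ⟨a, Finset.mem_filter.2 ⟨ha, hcase⟩, rfl⟩)
      · push Not at hcase
        have hτa : τ a = T₀ := by
          rcases h with h | h
          · exact absurd h (not_not.2 hcase.1)
          · exact (Finset.mem_insert.1 h).resolve_right hcase.2
        have hmem : L a + τ a ∈ F :=
          Finset.mem_image.2 ⟨a, Finset.mem_filter.2 ⟨ha, hcase.1, hτa⟩, rfl⟩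
        rw [hF _ hmem]
        simp [hτa]
  obtain ⟨z', hz', h⟩ := key ((S.filter fun a => Touched g n S c a).image τ)
  refine ⟨z', hz', fun a ha => h a ha ?_⟩
  by_cases hta : Touched g n S c a
  · exact Or.inr (Finset.mem_image.2 ⟨a, Finset.mem_filter.2 ⟨ha, hta⟩, rfl⟩)
  · exact Or.inl hta

/-! ### The extension property -/

/-- **Extension.** If `g · (w + 1) < n`, every record of the family with at most `w` literals
extends, for every variable, by some value of that variable inside the family: an out-of-range
variable freely; a variable of an already pebbled cell by the tile `z` carries there; a variable
of a new cell `c` by re-lifting the touched clusters (`exists_transl`, `goodLift_extend`), gluing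
the shifted copies of `z` (`exists_glued`) and reading the tile at the canonical lift of `c`.
[folklore] -/
theorem family_extend {g n : ℕ} {Y : Set (ℤ → ℤ → Fin t)}
    (hshift : ∀ x ∈ Y, ∀ a b : ℤ, (fun i j => x (i + a) (j + b)) ∈ Y)
    (hglue : ∀ E F : Finset (ℤ × ℤ), (∀ p ∈ E, ∀ q ∈ F, (g : ℤ) < max |p.1 - q.1| |p.2 - q.2|) →
      ∀ x ∈ Y, ∀ y ∈ Y, ∃ z ∈ Y, (∀ p ∈ E, z p.1 p.2 = x p.1 p.2) ∧ (∀ q ∈ F, z q.1 q.2 = y q.1 q.2))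
    {w : ℕ} (hw : (g : ℤ) * (w + 1) < n) {α : Finset (Literal ℕ)} (hα : α ∈ family t g n Y)
    (hcard : α.card ≤ w) (x : ℕ) : ∃ b : Bool, insert (x, b) α ∈ family t g n Y := by
  classical
  obtain ⟨L, z, hz, hL, hag⟩ := hα
  by_cases hx : x < n * n * t
  swap
  · -- an out-of-range variable is unconstrained
    refine ⟨true, L, z, hz, ?_, fun l hl hlt => ?_⟩
    · rw [cells_insert_of_le _ (not_lt.1 hx)]; exact hL
    · rcases Finset.mem_insert.1 hl with rfl | hl
      · exact absurd hlt hx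
      · exact hag l hl hlt
  by_cases hcS : cellOf t n x ∈ cells t n α
  · -- the cell is already pebbled: read the tile off `z`
    refine ⟨decide ((z (L (cellOf t n x)).1 (L (cellOf t n x)).2).1 = tileOf t x), L, z, hz, ?_,
      fun l hl hlt => ?_⟩
    · rw [cells_insert_of_lt _ hx, Finset.insert_eq_of_mem hcS]; exact hL
    · rcases Finset.mem_insert.1 hl with rfl | hl
      · simp only [decide_eq_true_eq]
      · exact hag l hl hlt
  · -- a new cell: re-lift the touched clusters and glue
    set c : ℕ × ℕ := cellOf t n x with hc
    set S : Finset (ℕ × ℕ) := cells t n α with hS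
    have hsmall : (g : ℤ) * (S.card + 1) < n := by
      have h1 : S.card ≤ w := (card_cells_le α).trans hcard
      have h2 : (g : ℤ) * (S.card + 1) ≤ g * (w + 1) := by
        apply mul_le_mul_of_nonneg_left _ (by positivity)
        exact_mod_cast Nat.succ_le_succ h1
      exact lt_of_le_of_lt h2 hw
    obtain ⟨τ, h0, h1, h2, h3⟩ := exists_transl hL c hsmall
    obtain ⟨z', hz', hzz'⟩ := exists_glued hshift hglue hL h0 h1 h2 hz
    let L' : ℕ × ℕ → ℤ × ℤ := fun a => if a = c then canon c else L a + τ a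
    have hL'c : L' c = canon c := by simp [L']
    have hL'S : ∀ a ∈ S, L' a = L a + τ a := fun a ha => by
      have : a ≠ c := fun h => hcS (h ▸ ha)
      simp [L', this]
    have hgood : GoodLift g n (insert c S) L' := goodLift_extend hL h0 h1 h2 h3 hL'c hL'S
    refine ⟨decide ((z' (canon c).1 (canon c).2).1 = tileOf t x), L', z', hz', ?_,
      fun l hl hlt => ?_⟩
    · rw [cells_insert_of_lt _ hx]; exact hgood
    · rcases Finset.mem_insert.1 hl with rfl | hl
      · change ((z' (L' c).1 (L' c).2).1 = tileOf t x ↔ _)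
        rw [hL'c]
        simp only [decide_eq_true_eq]
      · have ha : cellOf t n l.1 ∈ S := mem_cells_of_mem hl hlt
        rw [hL'S _ ha, hzz' _ ha]
        exact hag l hl hlt

/-! ### Gap zero: the torus CNF is satisfiable -/

/-- **Gap `0` forces torus tilings.** If `Y` is a gluing family with gap `0` then every `n × n`
torus is tiled by `T` (glue `x ∈ Y` with its shift by `n` across the last column, resp. the last
row: validity of the glued tiling is the wrap-around condition for `x|[0,n)²`), so `torusCNF T n`
is satisfiable. [folklore] -/
theorem satisfiable_of_gap_zero (T : WangTileSet (Fin t) C) {Y : Set (ℤ → ℤ → Fin t)}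
    (hY : GluingFamily T 0 Y) (n : ℕ) : (T.torusCNF n).Satisfiable := by
  classical
  obtain ⟨x, hx⟩ := hY.nonempty
  have hval := hY.valid x hx
  -- wrap-around across the last column
  have hwrapH : ∀ i : Fin n, T.east (x i ((n : ℤ) - 1)) = T.west (x i 0) := by
    intro i
    let E : Finset (ℤ × ℤ) := Finset.univ.image fun i : Fin n => ((i : ℤ), (n : ℤ) - 1)
    let F : Finset (ℤ × ℤ) := Finset.univ.image fun i : Fin n => ((i : ℤ), (n : ℤ))
    have hsep : ∀ p ∈ E, ∀ q ∈ F, ((0 : ℕ) : ℤ) < max |p.1 - q.1| |p.2 - q.2| := by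
      intro p hp q hq
      obtain ⟨a, -, rfl⟩ := Finset.mem_image.1 hp
      obtain ⟨b, -, rfl⟩ := Finset.mem_image.1 hq
      refine lt_max_of_lt_right ?_
      simp
    have hy : (fun a b => x (a + 0) (b + -(n : ℤ))) ∈ Y := hY.shift x hx 0 (-(n : ℤ))
    obtain ⟨z, hz, hE, hF⟩ := hY.glue E F hsep x hx _ hy
    have hzv := (hY.valid z hz (i : ℤ) ((n : ℤ) - 1)).1
    rw [hE _ (Finset.mem_image.2 ⟨i, Finset.mem_univ _, rfl⟩), sub_add_cancel,
      hF _ (Finset.mem_image.2 ⟨i, Finset.mem_univ _, rfl⟩)] at hzv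
    simpa using hzv
  -- wrap-around across the last row
  have hwrapV : ∀ j : Fin n, T.south (x ((n : ℤ) - 1) j) = T.north (x 0 j) := by
    intro j
    let E : Finset (ℤ × ℤ) := Finset.univ.image fun j : Fin n => ((n : ℤ) - 1, (j : ℤ))
    let F : Finset (ℤ × ℤ) := Finset.univ.image fun j : Fin n => ((n : ℤ), (j : ℤ))
    have hsep : ∀ p ∈ E, ∀ q ∈ F, ((0 : ℕ) : ℤ) < max |p.1 - q.1| |p.2 - q.2| := by
      intro p hp q hq
      obtain ⟨a, -, rfl⟩ := Finset.mem_image.1 hp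
      obtain ⟨b, -, rfl⟩ := Finset.mem_image.1 hq
      refine lt_max_of_lt_left ?_
      simp
    have hy : (fun a b => x (a + -(n : ℤ)) (b + 0)) ∈ Y := hY.shift x hx (-(n : ℤ)) 0
    obtain ⟨z, hz, hE, hF⟩ := hY.glue E F hsep x hx _ hy
    have hzv := (hY.valid z hz ((n : ℤ) - 1) (j : ℤ)).2
    rw [hE _ (Finset.mem_image.2 ⟨j, Finset.mem_univ _, rfl⟩), sub_add_cancel,
      hF _ (Finset.mem_image.2 ⟨j, Finset.mem_univ _, rfl⟩)] at hzv
    simpa using hzv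
  -- the restriction of `x` to `[0,n)²` is a torus tiling
  refine T.satisfiable_of_tilesTorus ⟨fun i j => x i j, fun i j => ⟨?_, ?_⟩⟩ <;> dsimp only
  · by_cases hj : j.1 + 1 < n
    · have e : (((⟨(j.1 + 1) % n, Nat.mod_lt _ j.pos⟩ : Fin n) : ℕ) : ℤ) = (j : ℤ) + 1 := by
        simp [Nat.mod_eq_of_lt hj]
      rw [e]; exact (hval i j).1
    · have hj' : j.1 + 1 = n := le_antisymm j.2 (not_lt.1 hj)
      have e : (((⟨(j.1 + 1) % n, Nat.mod_lt _ j.pos⟩ : Fin n) : ℕ) : ℤ) = 0 := by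
        simp [hj']
      have ej : ((j : ℕ) : ℤ) = (n : ℤ) - 1 := by
        have : (j.1 : ℤ) + 1 = n := by exact_mod_cast hj'
        linarith
      rw [e, ej]; exact hwrapH i
  · by_cases hi : i.1 + 1 < n
    · have e : (((⟨(i.1 + 1) % n, Nat.mod_lt _ i.pos⟩ : Fin n) : ℕ) : ℤ) = (i : ℤ) + 1 := by
        simp [Nat.mod_eq_of_lt hi]
      rw [e]; exact (hval i j).2
    · have hi' : i.1 + 1 = n := le_antisymm i.2 (not_lt.1 hi)
      have e : (((⟨(i.1 + 1) % n, Nat.mod_lt _ i.pos⟩ : Fin n) : ℕ) : ℤ) = 0 := by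
        simp [hi']
      have ei : ((i : ℕ) : ℤ) = (n : ℤ) - 1 := by
        have : (i.1 : ℤ) + 1 = n := by exact_mod_cast hi'
        linarith
      rw [e, ei]; exact hwrapV j

/-! ### The width bound -/

/-- **Resolution width of the torus CNFs of a gluing family.** If the valid `T`-tilings of `ℤ²`
contain a gluing family with gap `g` (nonempty, shift invariant, finite-set gluing at
sup-distance `> g`), then every resolution refutation `π` of `torusCNF T n` satisfies
`n ≤ g · (resWidth π + 2)` (for every `n`; the case `n = 0` is vacuous). For `g = 0` no refutation
exists; for `g ≥ 1` the Duplicator family `family t g n Y` defeats refutations of width `w`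
whenever `g (w + 2) < n`. [folklore] -/
theorem resWidth_torusCNF_of_gluing (T : WangTileSet (Fin t) C) {g : ℕ} {Y : Set (ℤ → ℤ → Fin t)}
    (hY : GluingFamily T g Y) {n : ℕ} {π : List (ResLine ℕ)}
    (hπ : IsResRefutation (T.torusCNF n) π) : n ≤ g * (resWidth π + 2) := by
  rcases Nat.eq_zero_or_pos g with rfl | hg
  · exact absurd (satisfiable_of_gap_zero T hY n) (not_satisfiable_of_isResRefutation_holds hπ)
  · by_contra hlt
    push Not at hlt
    set w := resWidth π with hw
    have hgn : g + 1 < n := by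
      have : g + 1 ≤ g * (w + 2) := by nlinarith
      omega
    have hgw : (g : ℤ) * (w + 1) < n := by
      have : g * (w + 1) < n := lt_of_le_of_lt (Nat.mul_le_mul_left _ (Nat.le_succ _)) hlt
      exact_mod_cast this
    have h := lt_resWidth_of_family (φ := T.torusCNF n) (w := w) (H := family t g n Y)
      ⟨∅, empty_mem_family hY.nonempty⟩ (fun α hα β hβ => family_down hα hβ)
      (fun α hα => family_consistent T hY hg hgn hα)
      (fun α hα hcard x => family_extend hY.shift hY.glue hgw hα hcard x) hπ
    exact lt_irrefl _ h

end TorusGluing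

end Literature.Dynamics.Tilings
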